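import Mathlib

/-!
# Support item `RigidityForcesSymmetry.RankInfRigidToLocallyOpen` (stmt-ValiantsHypothesis-24282) —
# the rank chart: a `{1}`-inverse and the algebraic half of the Schur-type map

Route `ValiantsHypothesis/RigidityForcesSymmetry`, sub-crux A2 of crux `RankRigidMinimalRepr` (stmt-18034):
the RANK-CONSTRAINED SLICE LEMMA.  The rank constraint `rank (A + W) ≤ rank A` near a square matrix `A` is
encoded, WITHOUT block decompositions or normal forms in the statement, through a `{1}`-inverse `A⁺`
(`A A⁺ A = A`), the kernel idempotent `K = 1 - A⁺A` (`A K = 0`, `K = id` on `ker A`) and the cokernel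
idempotent `Y = 1 - A A⁺` (`Y A = 0`, `ker Y ⊆ im A`):

* `exists_one_inverse` — every square matrix over a field has a `{1}`-inverse (transvection
  diagonalisation `Matrix.Pivot.exists_list_transvec_mul_mul_list_transvec_eq_diagonal`).
* `mul_inv_mul_kerProj_eq_zero` — **the rank lemma**: if `g = 1 + A⁺(B - A)` is invertible and
  `rank B ≤ rank A` then `B g⁻¹ K = 0`.  Proof: `A A⁺ B = A g`, so `A A⁺ (B g⁻¹) = A`, whence
  `ker (B g⁻¹) ≤ ker A`; rank–nullity and `rank (B g⁻¹) ≤ rank B ≤ rank A` force equality of the kernels,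
  and `K` maps into `ker A`.
* `schurMap_eq_zero` — consequently the SCHUR-TYPE MAP `F(W) = Y · W · (1 + A⁺W)⁻¹ · K` vanishes at every
  `W` with `rank (A + W) ≤ rank A` and `det (1 + A⁺W) ≠ 0`.
* `rankTangent_of_coker_mul_mul_ker_eq_zero` — the differential side: `Y B K = 0` says exactly that `B`
  maps `ker A` into `im A` (`∀ w, A w = 0 → ∃ u, B w = A u`, the item's rank-tangency clause).

These feed the local-injectivity step of the slice argument (file `…RankInfRigidToLocallyOpenLocInj`).
-/

set_option autoImplicit false

-- the mandated summit-side namespace repeats a component by design (single-problem summit)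
set_option linter.dupNamespace false

namespace Summit.ValiantsHypothesis.ValiantsHypothesis.Theorems.RigidityForcesSymmetry.RankSlice

open Matrix

variable {K : Type*} [Field K] {n : Type*} [Fintype n] [DecidableEq n]

/-- Every square matrix over a field has a `{1}`-inverse: `∃ A⁺, A A⁺ A = A`
(from the transvection diagonalisation `E A E' = diagonal D`: take `A⁺ = E' · diagonal D⁻¹ · E`). -/
theorem exists_one_inverse (A : Matrix n n K) : ∃ Ap : Matrix n n K, A * Ap * A = A := by
  obtain ⟨L, L', D, h⟩ := Matrix.Pivot.exists_list_transvec_mul_mul_list_transvec_eq_diagonal A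
  set E : Matrix n n K := (L.map Matrix.TransvectionStruct.toMatrix).prod with hE
  set E' : Matrix n n K := (L'.map Matrix.TransvectionStruct.toMatrix).prod with hE'
  have hEu : IsUnit E.det := by
    rw [hE, Matrix.TransvectionStruct.det_toMatrix_prod]; exact isUnit_one
  have hE'u : IsUnit E'.det := by
    rw [hE', Matrix.TransvectionStruct.det_toMatrix_prod]; exact isUnit_one
  -- `A E' = E⁻¹ D` and `E A = D E'⁻¹`
  have h1 : A * E' = E⁻¹ * diagonal D := by
    rw [← h, ← Matrix.mul_assoc, ← Matrix.mul_assoc, Matrix.nonsing_inv_mul _ hEu, Matrix.one_mul]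
  have h2 : E * A = diagonal D * E'⁻¹ := by
    rw [← h, Matrix.mul_assoc (E * A), Matrix.mul_nonsing_inv _ hE'u, Matrix.mul_one]
  have h3 : A = E⁻¹ * diagonal D * E'⁻¹ := by
    rw [← h]
    simp only [Matrix.mul_assoc]
    rw [Matrix.mul_nonsing_inv _ hE'u, Matrix.mul_one, ← Matrix.mul_assoc,
      Matrix.nonsing_inv_mul _ hEu, Matrix.one_mul]
  have hD : diagonal D * diagonal (fun i => (D i)⁻¹) * diagonal D = diagonal D := by
    rw [diagonal_mul_diagonal, diagonal_mul_diagonal]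
    congr 1
    funext i
    rcases eq_or_ne (D i) 0 with hi | hi
    · simp [hi]
    · rw [mul_inv_cancel₀ hi, one_mul]
  refine ⟨E' * diagonal (fun i => (D i)⁻¹) * E, ?_⟩
  calc A * (E' * diagonal (fun i => (D i)⁻¹) * E) * A
      = (A * E') * diagonal (fun i => (D i)⁻¹) * (E * A) := by
        simp only [Matrix.mul_assoc]
    _ = E⁻¹ * (diagonal D * diagonal (fun i => (D i)⁻¹) * diagonal D) * E'⁻¹ := by
        rw [h1, h2]; simp only [Matrix.mul_assoc]
    _ = A := by rw [hD, h3]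

/-- **The rank lemma.**  Let `A A⁺ A = A`, let `g = 1 + A⁺ (B - A)` have invertible determinant and
`rank B ≤ rank A`.  Then `B · g⁻¹ · (1 - A⁺A) = 0`, i.e. `B g⁻¹` kills `ker A` (in fact
`ker (B g⁻¹) = ker A`, from `A A⁺ (B g⁻¹) = A` and rank–nullity). -/
theorem mul_inv_mul_kerProj_eq_zero {A Ap B : Matrix n n K} (hAp : A * Ap * A = A)
    (hg : IsUnit (1 + Ap * (B - A)).det) (hr : B.rank ≤ A.rank) :
    B * (1 + Ap * (B - A))⁻¹ * (1 - Ap * A) = 0 := by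
  set g : Matrix n n K := 1 + Ap * (B - A) with hg_def
  -- `A A⁺ B = A g`
  have h1 : A * Ap * B = A * g := by
    rw [hg_def, Matrix.mul_add, Matrix.mul_one, Matrix.mul_sub, Matrix.mul_sub, ← Matrix.mul_assoc,
      ← Matrix.mul_assoc, hAp]
    abel
  -- `A A⁺ (B g⁻¹) = A`
  have h2 : A * Ap * (B * g⁻¹) = A := by
    rw [← Matrix.mul_assoc, h1, Matrix.mul_assoc, Matrix.mul_nonsing_inv _ hg, Matrix.mul_one]
  set Bt : Matrix n n K := B * g⁻¹ with hBt
  -- `ker (B g⁻¹) ≤ ker A`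
  have hker : LinearMap.ker Bt.mulVecLin ≤ LinearMap.ker A.mulVecLin := by
    intro x hx
    rw [LinearMap.mem_ker, Matrix.mulVecLin_apply] at hx ⊢
    have hx' : (A * Ap * Bt) *ᵥ x = A *ᵥ x := by rw [h2]
    rw [← hx', ← Matrix.mulVec_mulVec, hx, Matrix.mulVec_zero]
  -- `rank (B g⁻¹) ≤ rank B ≤ rank A`, so the kernels have the same dimension and coincide
  have hrank : Bt.rank ≤ A.rank := (Matrix.rank_mul_le_left B g⁻¹).trans hr
  have hfin : Module.finrank K (LinearMap.ker A.mulVecLin) ≤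
      Module.finrank K (LinearMap.ker Bt.mulVecLin) := by
    have hA := LinearMap.finrank_range_add_finrank_ker A.mulVecLin
    have hB := LinearMap.finrank_range_add_finrank_ker Bt.mulVecLin
    unfold Matrix.rank at hrank
    omega
  have hkeq : LinearMap.ker Bt.mulVecLin = LinearMap.ker A.mulVecLin :=
    Submodule.eq_of_le_of_finrank_le hker hfin
  -- conclude on vectors: `(1 - A⁺A) x ∈ ker A = ker (B g⁻¹)`
  apply Matrix.toLin'.injective
  refine LinearMap.ext fun x => ?_
  rw [Matrix.toLin'_apply, Matrix.toLin'_apply, Matrix.zero_mulVec, ← Matrix.mulVec_mulVec]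
  have hxk : (1 - Ap * A) *ᵥ x ∈ LinearMap.ker A.mulVecLin := by
    rw [LinearMap.mem_ker, Matrix.mulVecLin_apply, Matrix.mulVec_mulVec, Matrix.mul_sub,
      Matrix.mul_one, ← Matrix.mul_assoc, hAp, sub_self, Matrix.zero_mulVec]
  rw [← hkeq, LinearMap.mem_ker, Matrix.mulVecLin_apply] at hxk
  exact hxk

/-- The cokernel idempotent kills `A`: `(1 - A A⁺) A = 0`. -/
theorem coker_mul_self {A Ap : Matrix n n K} (hAp : A * Ap * A = A) : (1 - A * Ap) * A = 0 := by
  rw [Matrix.sub_mul, Matrix.one_mul, hAp, sub_self]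

/-- `A` kills the kernel idempotent: `A (1 - A⁺A) = 0`. -/
theorem self_mul_ker {A Ap : Matrix n n K} (hAp : A * Ap * A = A) : A * (1 - Ap * A) = 0 := by
  rw [Matrix.mul_sub, Matrix.mul_one, ← Matrix.mul_assoc, hAp, sub_self]

/-- **The Schur-type map vanishes on the rank stratum.**  With `A A⁺ A = A`, for every `W` with
`det (1 + A⁺W) ≠ 0` and `rank (A + W) ≤ rank A`:  `(1 - A A⁺) · W · (1 + A⁺W)⁻¹ · (1 - A⁺A) = 0`. -/
theorem schurMap_eq_zero {A Ap W : Matrix n n K} (hAp : A * Ap * A = A)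
    (hg : IsUnit (1 + Ap * W).det) (hr : (A + W).rank ≤ A.rank) :
    (1 - A * Ap) * W * (1 + Ap * W)⁻¹ * (1 - Ap * A) = 0 := by
  have hg' : IsUnit (1 + Ap * (A + W - A)).det := by rwa [add_sub_cancel_left]
  have h := mul_inv_mul_kerProj_eq_zero hAp hg' hr
  rw [add_sub_cancel_left] at h
  have h' : (1 - A * Ap) * ((A + W) * (1 + Ap * W)⁻¹ * (1 - Ap * A)) = 0 := by
    rw [h, Matrix.mul_zero]
  rw [Matrix.add_mul, Matrix.add_mul, Matrix.mul_add, ← Matrix.mul_assoc, ← Matrix.mul_assoc,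
    coker_mul_self hAp, Matrix.zero_mul, Matrix.zero_mul, zero_add] at h'
  simpa only [Matrix.mul_assoc] using h'

/-- **Rank-tangency from the differential of the Schur-type map.**  If
`(1 - A A⁺) · B · (1 - A⁺A) = 0` (for ANY `A⁺`), then `B` maps `ker A` into `im A`:
`∀ w, A w = 0 → ∃ u, B w = A u` (the item's rank-tangency clause). -/
theorem rankTangent_of_coker_mul_mul_ker_eq_zero {A Ap B : Matrix n n K}
    (h : (1 - A * Ap) * B * (1 - Ap * A) = 0) :
    ∀ w : n → K, A *ᵥ w = 0 → ∃ u : n → K, B *ᵥ w = A *ᵥ u := by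
  intro w hw
  refine ⟨Ap *ᵥ (B *ᵥ w), ?_⟩
  have h1 : (1 - Ap * A) *ᵥ w = w := by
    rw [Matrix.sub_mulVec, Matrix.one_mulVec, ← Matrix.mulVec_mulVec, hw, Matrix.mulVec_zero,
      sub_zero]
  have h2 : ((1 - A * Ap) * B * (1 - Ap * A)) *ᵥ w = 0 := by rw [h, Matrix.zero_mulVec]
  rw [← Matrix.mulVec_mulVec, h1, ← Matrix.mulVec_mulVec, Matrix.sub_mulVec, Matrix.one_mulVec,
    sub_eq_zero, ← Matrix.mulVec_mulVec] at h2
  exact h2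

end Summit.ValiantsHypothesis.ValiantsHypothesis.Theorems.RigidityForcesSymmetry.RankSlice
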